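import Summits.BirchSwinnertonDyer.BirchSwinnertonDyer.Theorems.CyclotomicUntwistGNineKernelNine
import Summits.BirchSwinnertonDyer.BirchSwinnertonDyer.Theorems.CyclotomicUntwistGNineArithmetic
import Summits.BirchSwinnertonDyer.Rank1Residual.Additive.TypeGThreeUnitJ
import Summits.BirchSwinnertonDyer.Rank1Residual.WAll.TargetAdditiveAtThreePotSSImage
import Summits.BirchSwinnertonDyer.Rank1Residual.Additive.WildThreeKrausCells
import Summits.BirchSwinnertonDyer.BirchSwinnertonDyer.Theses.CyclotomicUntwist
import Literature.NumberTheory.EllipticCurves.KrausNonMinimalityTwoThreeProofs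
import HarnessLib

/-!
# `GNineCriterion` — the FIRST LEMMA of route `CyclotomicUntwist`: on the wild cell at `3`, a
# `3`-adic-square minimal discriminant forces good reduction over `ℚ(ζ₉)` (`TypeGNine`)

Route `CyclotomicUntwist` (sub-problem `BirchSwinnertonDyer`), crux `PSRankOneLowerHalfAtThree`
(item stmt-BirchSwinnertonDyer-21580), registered line `birth`
(`Cruxes/PSRankOneLowerHalfAtThree/Lines/birth.lean`), stub **`stub_gNineCriterion`** — proved
here BY NAME with the registered signature:

  `ClassO6 W 3 → Even (ord₃ Δ_min) → (Δ_min / 3^{ord₃ Δ_min}) % 3 = 1 → TypeGNine W`.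

This is the route's kill criterion (ii) settled on the positive side: the principal-series rows
(`Δ_min ∈ (ℚ₃^×)²`) of the wild cell ARE of type `(G₉)` — `E` acquires good reduction over the
`9`-th cyclotomic field. (In fact the proof uses of `ClassO6` only "additive at `3`" and
"`ord₃ j ≥ 0`": the wildness bit `f₃ ≠ 2` is idle, the tame `I₀*` rows being of type `(G₉)` too.)

Proof (Tate's algorithm at `3` made explicit; no Kodaira symbols, no local class field theory):
the integer cubic model `y² = x³ + b₂x² + 8b₄x + 16b₆` of the globally minimal `W`
(`GNineCriterion.hasGoodReductionAt_iff_cubicModel`) has `disc = 2⁸ Δ_min = 3^v·d`, `d ≡ 1 (3)`,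
`3 ∣ b₂` (additive: `3 ∣ c₄ = b₂² − 24b₄`), `v ≤ 13` (Kraus's minimality criterion at `3`,
`not_pow_dvd_c₄_minimalDiscriminantInt_three`, with `3·ord₃ c₄ ≥ v`); the arithmetic of
`CyclotomicUntwistGNineArithmetic.lean` turns `v ∈ {4, 6}` into the residue patterns whose explicit
witnesses `r ∈ {ε ϖ, 0, ε ϖ²}` (`ϖ = 2 − ζ − ζ⁻¹`), `u = (ζ − 1)^{v/2}` give an integral model with
unit discriminant at the place over `3` of `ℚ(ζ₉)` (`CyclotomicUntwistGNineKernelNine.lean`), and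
`v ∈ {8, 10, 12}` is reduced to `v − 6` by the `ℚ(√−3)`-twist (`√−3 = 2ζ³ + 1 ∈ ℚ(ζ₉)`).
* `GNineCriterion.hasGoodReductionAt_of_squareDisc` — the statement over `F ∋ ζ₉` for an integer
  cubic with `3 ∣ A`, `disc = 3^v d`, `d ≡ 1 (3)`, `v` even, `1 ≤ v ≤ 13`, `27 ∣ A² − 3B` if `v ≥ 8`;
* `GNineCriterion.typeGNine_of_square_minimalDiscriminant` — `Addv W 3 → ¬PotMult W 3 →
  Even v → unit part ≡ 1 → TypeGNine W`;
* `Cruxes.PSRankOneLowerHalfAtThree.Birth.stub_gNineCriterion` — the registered stub, by name.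

HONEST FRAMING: a lemma about reduction types; it closes a stub of a line, not the crux
`PSRankOneLowerHalfAtThree` (the 3-adic Gross–Zagier / IMC content of the line is untouched);
BSD is not advanced by this file. No definition, no named fact, standard axioms.
References: A. Kraus, Manuscripta Math. 69 (1990) 353–385; J. Tate, Antwerp IV (1975);
J. H. Silverman, *AEC* VII.1, VII.5; D. Delbourgo, Compositio Math. 113 (1998) §1.5 (G).
-/

noncomputable section

open scoped Classical NumberField

open WeierstrassCurve IsDedekindDomain IsDedekindDomain.HeightOneSpectrum NumberField WithZero
  Literature.NumberTheory.EllipticCurves Literature.NumberTheory.EllipticCurves.Rank1Residual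
  Summit.BirchSwinnertonDyer.Rank1Residual.Additive

set_option linter.dupNamespace false

namespace Summit.BirchSwinnertonDyer.BirchSwinnertonDyer.Theorems.GNineCriterion

/-! ### Over a field with a primitive `9`-th root of unity: the integer cubic with square discriminant -/

section OverF

variable {F : Type*} [Field F] [NumberField F] {ζ : F} (hζ : IsPrimitiveRoot ζ 9)
  (w : HeightOneSpectrum (𝓞 F))
  (hπ : w.valuation F (ζ - 1) = exp (-1 : ℤ)) (h3 : w.valuation F (3 : F) = exp (-6 : ℤ))
  (hcop : ∀ n : ℤ, ¬ (3 : ℤ) ∣ n → w.valuation F (n : F) = 1)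

include hζ hπ h3 hcop in
/-- **Low discriminant valuation (`1 ≤ v ≤ 7`).** For an integer cubic with `3 ∣ A`,
`disc = 3^v·d`, `d ≡ 1 (mod 3)`, `v` even: after the cusp translation `v ∈ {4, 6}` and the residue
patterns of `pattern_four` / `pattern_six` feed the explicit kernels. [cite: Kraus1990, Théorème 1 (p = 3)] -/
theorem hasGoodReductionAt_of_squareDisc_low (A B C : ℤ) (v : ℕ) (d : ℤ) (h3A : (3 : ℤ) ∣ A)
    (hD : A ^ 2 * B ^ 2 - 4 * B ^ 3 - 4 * A ^ 3 * C - 27 * C ^ 2 + 18 * A * B * C = 3 ^ v * d)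
    (hd : d % 3 = 1) (hv : Even v) (hv1 : 1 ≤ v) (hv7 : v ≤ 7) :
    (⟨0, (A : F), 0, (B : F), (C : F)⟩ : WeierstrassCurve F).HasGoodReductionAt w := by
  have h3d : ¬ (3 : ℤ) ∣ d := by omega
  have h3D : (3 : ℤ) ∣ A ^ 2 * B ^ 2 - 4 * B ^ 3 - 4 * A ^ 3 * C - 27 * C ^ 2 + 18 * A * B * C := by
    rw [hD]
    exact dvd_mul_of_dvd_left (dvd_pow_self 3 (by omega)) d
  obtain ⟨t, htA, htB, htC⟩ := exists_translate_three_dvd A B C h3A h3D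
  rw [hasGoodReductionAt_iff_translate w (A : F) (B : F) (C : F) (t : F)]
  have e2 : (A : F) + 3 * (t : F) = ((A + 3 * t : ℤ) : F) := by push_cast; ring
  have e4 : (B : F) + 2 * (t : F) * (A : F) + 3 * (t : F) ^ 2 =
      ((B + 2 * t * A + 3 * t ^ 2 : ℤ) : F) := by push_cast; ring
  have e6 : (C : F) + (t : F) * (B : F) + (t : F) ^ 2 * (A : F) + (t : F) ^ 3 =
      ((C + t * B + t ^ 2 * A + t ^ 3 : ℤ) : F) := by push_cast; ring
  rw [e2, e4, e6]
  set A' : ℤ := A + 3 * t with hA'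
  set B' : ℤ := B + 2 * t * A + 3 * t ^ 2 with hB'
  set C' : ℤ := C + t * B + t ^ 2 * A + t ^ 3 with hC'
  have hD' : A' ^ 2 * B' ^ 2 - 4 * B' ^ 3 - 4 * A' ^ 3 * C' - 27 * C' ^ 2 + 18 * A' * B' * C' =
      3 ^ v * d := by rw [hA', hB', hC', disc_translate, hD]
  -- `27 ∣ disc`, so `v ≥ 3`, so `v ∈ {4, 6}`
  obtain ⟨a, ha⟩ := htA
  obtain ⟨b, hb⟩ := htB
  obtain ⟨c, hc⟩ := htC
  have h27 : (27 : ℤ) ∣ 3 ^ v * d := by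
    rw [← hD', ha, hb, hc, disc_eq_of_three_dvd]; exact dvd_mul_right 27 _
  have hv46 : v = 4 ∨ v = 6 := by
    obtain ⟨k, hk⟩ := hv
    interval_cases v <;> omega
  rcases hv46 with rfl | rfl
  · obtain ⟨ε, α', β', γ', hε, h1, h2, h3'⟩ :=
      pattern_four A' B' C' d ⟨a, ha⟩ ⟨b, hb⟩ ⟨c, hc⟩ (by linarith) hd
    exact hasGoodReductionAt_of_pattern_four hζ w hπ h3 hcop A' B' C' ε α' β' γ' d hε h1 h2 h3'
      (by linarith) h3d
  · rcases pattern_six A' B' C' d ⟨a, ha⟩ ⟨b, hb⟩ ⟨c, hc⟩ (by linarith) hd with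
      ⟨a₁, b₁, c₁, h1, h2, h3'⟩ | ⟨ε, α₁, β₂, γ₂, hε, h1, h2, h3'⟩
    · exact hasGoodReductionAt_of_pattern_six_zero w hπ h3 hcop A' B' C' a₁ b₁ c₁ d h1 h2 h3'
        (by linarith) h3d
    · exact hasGoodReductionAt_of_pattern_six hζ w hπ h3 hcop A' B' C' ε α₁ β₂ γ₂ d hε h1 h2 h3'
        (by linarith) h3d

include hζ hπ h3 hcop in
/-- **The square-discriminant criterion over `F ∋ ζ₉`.** For an integer cubic with `3 ∣ A`,
`disc = 3^v·d`, `d ≡ 1 (mod 3)`, `v` even, `1 ≤ v ≤ 13`, and `27 ∣ A² − 3B` whenever `v ≥ 8`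
(potentially good reduction), `y² = x³ + A x² + B x + C` has good reduction at `w`: `v ≤ 7` is the
low case; for `v ≥ 8` the pattern `9 ∣ A, 27 ∣ B, 27 ∣ C` makes the `ℚ(√−3)`-twist integral with
`v` lowered by `6`. [cite: Kraus1990, Théorème 1 (p = 3)] -/
theorem hasGoodReductionAt_of_squareDisc (A B C : ℤ) (v : ℕ) (d : ℤ) (h3A : (3 : ℤ) ∣ A)
    (hD : A ^ 2 * B ^ 2 - 4 * B ^ 3 - 4 * A ^ 3 * C - 27 * C ^ 2 + 18 * A * B * C = 3 ^ v * d)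
    (hd : d % 3 = 1) (hv : Even v) (hv1 : 1 ≤ v) (hv13 : v ≤ 13)
    (hc4 : 8 ≤ v → (27 : ℤ) ∣ A ^ 2 - 3 * B) :
    (⟨0, (A : F), 0, (B : F), (C : F)⟩ : WeierstrassCurve F).HasGoodReductionAt w := by
  by_cases hv7 : v ≤ 7
  · exact hasGoodReductionAt_of_squareDisc_low hζ w hπ h3 hcop A B C v d h3A hD hd hv hv1 hv7
  have hv8 : 8 ≤ v := by omega
  have h3D : (3 : ℤ) ∣ A ^ 2 * B ^ 2 - 4 * B ^ 3 - 4 * A ^ 3 * C - 27 * C ^ 2 + 18 * A * B * C := by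
    rw [hD]
    exact dvd_mul_of_dvd_left (dvd_pow_self 3 (by omega)) d
  obtain ⟨t, htA, htB, htC⟩ := exists_translate_three_dvd A B C h3A h3D
  rw [hasGoodReductionAt_iff_translate w (A : F) (B : F) (C : F) (t : F)]
  have e2 : (A : F) + 3 * (t : F) = ((A + 3 * t : ℤ) : F) := by push_cast; ring
  have e4 : (B : F) + 2 * (t : F) * (A : F) + 3 * (t : F) ^ 2 =
      ((B + 2 * t * A + 3 * t ^ 2 : ℤ) : F) := by push_cast; ring
  have e6 : (C : F) + (t : F) * (B : F) + (t : F) ^ 2 * (A : F) + (t : F) ^ 3 =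
      ((C + t * B + t ^ 2 * A + t ^ 3 : ℤ) : F) := by push_cast; ring
  rw [e2, e4, e6]
  set A' : ℤ := A + 3 * t with hA'
  set B' : ℤ := B + 2 * t * A + 3 * t ^ 2 with hB'
  set C' : ℤ := C + t * B + t ^ 2 * A + t ^ 3 with hC'
  have hD' : A' ^ 2 * B' ^ 2 - 4 * B' ^ 3 - 4 * A' ^ 3 * C' - 27 * C' ^ 2 + 18 * A' * B' * C' =
      3 ^ v * d := by rw [hA', hB', hC', disc_translate, hD]
  have hc4' : (27 : ℤ) ∣ A' ^ 2 - 3 * B' := by rw [hA', hB', csub_translate]; exact hc4 hv8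
  have h8 : (3 : ℤ) ^ 8 ∣ A' ^ 2 * B' ^ 2 - 4 * B' ^ 3 - 4 * A' ^ 3 * C' - 27 * C' ^ 2
      + 18 * A' * B' * C' := by
    rw [hD']; exact dvd_mul_of_dvd_left (pow_dvd_pow 3 hv8) d
  obtain ⟨a, b, c, h1, h2, h3'⟩ := pattern_high A' B' C' htA htB htC h8 hc4'
  -- the twist: `(9a, 27b, 27c) = (3·3a, 9·3b, 27·c) ↦ (−3a, 3b, −c)`
  have e2' : ((A' : ℤ) : F) = 3 * ((3 * a : ℤ) : F) := by rw [h1]; push_cast; ring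
  have e4' : ((B' : ℤ) : F) = 9 * ((3 * b : ℤ) : F) := by rw [h2]; push_cast; ring
  have e6' : ((C' : ℤ) : F) = 27 * ((c : ℤ) : F) := by rw [h3']
                                                        ; push_cast; ring
  rw [e2', e4', e6', hasGoodReductionAt_iff_twistScale hζ w]
  have f2 : -((3 * a : ℤ) : F) = ((-(3 * a) : ℤ) : F) := by push_cast; ring
  have f6 : -((c : ℤ) : F) = ((-c : ℤ) : F) := by push_cast; ring
  rw [f2, f6]
  -- the twisted cubic: `disc'' · 3⁶ = disc'`, so `disc'' = 3^(v−6) d`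
  obtain ⟨m, hm⟩ : ∃ m : ℕ, v = m + 6 := ⟨v - 6, by omega⟩
  have hDtw : (-(3 * a)) ^ 2 * (3 * b) ^ 2 - 4 * (3 * b) ^ 3 - 4 * (-(3 * a)) ^ 3 * (-c)
      - 27 * (-c) ^ 2 + 18 * (-(3 * a)) * (3 * b) * (-c) = 3 ^ m * d := by
    have key := disc_twist a b c
    rw [← h1, ← h2, ← h3', hD', hm, pow_add] at key
    have h36 : (3 : ℤ) ^ 6 ≠ 0 := by norm_num
    apply mul_right_cancel₀ h36
    linarith
  refine hasGoodReductionAt_of_squareDisc_low hζ w hπ h3 hcop (-(3 * a)) (3 * b) (-c) m d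
    ⟨-a, by ring⟩ hDtw hd ?_ (by omega) (by omega)
  obtain ⟨k, hk⟩ := hv
  exact ⟨k - 3, by omega⟩

end OverF

/-! ### From the globally minimal model over `ℚ` to `TypeGNine` -/

section Rat

variable (W : WeierstrassCurve ℚ) [W.IsElliptic] [W.IsGloballyMinimal]

/-- Potentially good reduction at `3` (`ord₃ j ≥ 0`) in integer form: `3^k ∣ c₄` whenever
`3k ≤ ord₃ Δ_min + 2` (i.e. `k ≤ ⌈ord₃ Δ_min / 3⌉`; `j = c₄³/Δ`). [folklore] -/
theorem pow_dvd_c₄_of_not_potMult (hpm : ¬ PotMult W 3) (k : ℕ)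
    (hk : 3 * k ≤ padicValInt 3 (integralModelInt W).Δ + 2) :
    (3 : ℤ) ^ k ∣ (integralModelInt W).c₄ := by
  haveI : Fact (Nat.Prime 3) := ⟨Nat.prime_three⟩
  by_cases hc0 : (integralModelInt W).c₄ = 0
  · rw [hc0]; exact dvd_zero _
  have hc : W.c₄ = ((integralModelInt W).c₄ : ℚ) :=
    Summit.BirchSwinnertonDyer.BirchSwinnertonDyer.Rank1Residual.IntModel.c₄_eq_cast rfl
  have hΔ : W.Δ = ((integralModelInt W).Δ : ℚ) :=
    Summit.BirchSwinnertonDyer.BirchSwinnertonDyer.Rank1Residual.IntModel.Δ_eq_cast rfl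
  have hΔ0 : (integralModelInt W).Δ ≠ 0 := minimalDiscriminantInt_ne_zero W
  have hjq : W.j = W.c₄ ^ 3 / W.Δ := by
    rw [WeierstrassCurve.j, ← coe_Δ', div_eq_inv_mul, Units.val_inv_eq_inv_val]
  have hj : 0 ≤ padicValRat 3 W.j := not_lt.mp hpm
  rw [hjq, hc, hΔ, padicValRat.div (pow_ne_zero _ (by exact_mod_cast hc0)) (by exact_mod_cast hΔ0),
    padicValRat.pow, padicValRat.of_int, padicValRat.of_int] at hj
  rw [three_pow_dvd_iff]
  right
  push_cast at hj
  omega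

/-- **`ord₃ Δ_min ≤ 13` at a potentially good `3`** (Kraus's minimality criterion at `3`: not
`3⁵ ∣ c₄ ∧ 3¹⁴ ∣ Δ_min`; with `3·ord₃ c₄ ≥ ord₃ Δ_min`). [cite: Kraus1989, Prop. 1] -/
theorem padicValInt_Δ_le_thirteen (hpm : ¬ PotMult W 3) :
    padicValInt 3 (integralModelInt W).Δ ≤ 13 := by
  by_contra h
  have h14 : 14 ≤ padicValInt 3 (integralModelInt W).Δ := by omega
  apply not_pow_dvd_c₄_minimalDiscriminantInt_three W
  refine ⟨pow_dvd_c₄_of_not_potMult W hpm 5 (by omega), ?_⟩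
  rw [WeierstrassCurve.minimalDiscriminantInt, three_pow_dvd_iff]
  exact Or.inr h14

/-- **`GNineCriterion`, curve form.** A globally minimal `E/ℚ`, additive at `3` with `ord₃ j ≥ 0`,
`ord₃ Δ_min` even and `Δ_min / 3^{ord₃ Δ_min} ≡ 1 (mod 3)` (i.e. `Δ_min ∈ (ℚ₃^×)²`) acquires good
reduction over the `9`-th cyclotomic field at every place above `3`: `TypeGNine W` with witness
`F = ℚ(ζ₉)` itself. [cite: Kraus1990, Théorème 1 (p = 3)] [cite: Delbourgo1998, §1.5 (G)] -/
theorem typeGNine_of_square_minimalDiscriminant (hadd : Addv W 3) (hpm : ¬ PotMult W 3)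
    (hev : Even (padicValInt 3 W.minimalDiscriminantInt))
    (hsq : W.minimalDiscriminantInt / 3 ^ padicValInt 3 W.minimalDiscriminantInt % 3 = 1) :
    TypeGNine W := by
  haveI hp3 : Fact (Nat.Prime 3) := ⟨Nat.prime_three⟩
  -- integer data
  set E₀ : WeierstrassCurve ℤ := integralModelInt W with hE₀
  set A : ℤ := E₀.b₂ with hA
  set B : ℤ := 8 * E₀.b₄ with hB
  set C : ℤ := 16 * E₀.b₆ with hC
  set v : ℕ := padicValInt 3 E₀.Δ with hvdef
  have hmin : W.minimalDiscriminantInt = E₀.Δ := rfl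
  rw [hmin] at hev hsq
  have hc4E : E₀.c₄ = A ^ 2 - 3 * B := c₄_eq_b₂_sq_sub E₀
  have hDE : A ^ 2 * B ^ 2 - 4 * B ^ 3 - 4 * A ^ 3 * C - 27 * C ^ 2 + 18 * A * B * C =
      256 * E₀.Δ := disc_b_eq E₀
  have hΔ0 : E₀.Δ ≠ 0 := minimalDiscriminantInt_ne_zero W
  have h3c4 : (3 : ℤ) ∣ A ^ 2 - 3 * B := hc4E ▸ three_dvd_c₄_of_addv W hadd
  have h3A : (3 : ℤ) ∣ A := by
    have : (3 : ℤ) ∣ A ^ 2 := by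
      have := dvd_add h3c4 (dvd_mul_right 3 B)
      simpa using this
    exact Int.prime_three.dvd_of_dvd_pow this
  have h3Δ : (3 : ℤ) ∣ E₀.Δ := three_dvd_Δ_of_not_good W hadd.1
  have hv1 : 1 ≤ v := by
    have := (three_pow_dvd_iff 1 E₀.Δ).mp (by simpa using h3Δ)
    exact (this.resolve_left hΔ0)
  have hv13 : v ≤ 13 := padicValInt_Δ_le_thirteen W hpm
  -- `E₀.Δ = 3^v · d₀` with `d₀ % 3 = 1`
  obtain ⟨d₀, hd₀⟩ : (3 : ℤ) ^ v ∣ E₀.Δ := (three_pow_dvd_iff v E₀.Δ).mpr (Or.inr le_rfl)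
  have hd₀' : E₀.Δ / 3 ^ v = d₀ := by
    rw [hd₀, Int.mul_ediv_cancel_left _ (pow_ne_zero _ (by norm_num))]
  rw [hd₀'] at hsq
  have hD : A ^ 2 * B ^ 2 - 4 * B ^ 3 - 4 * A ^ 3 * C - 27 * C ^ 2 + 18 * A * B * C =
      3 ^ v * (256 * d₀) := by rw [hDE, hd₀]; ring
  have hd : 256 * d₀ % 3 = 1 := by omega
  have hc4 : 8 ≤ v → (27 : ℤ) ∣ A ^ 2 - 3 * B := fun h8 ↦ by
    rw [← hc4E]; exact pow_dvd_c₄_of_not_potMult W hpm 3 (by rw [← hE₀]; omega)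
  -- the field `F = ℚ(ζ₉)` (as the top intermediate field of `CyclotomicField 9 ℚ`)
  haveI hcyc : IsCyclotomicExtension {9} ℚ (CyclotomicField 9 ℚ) := by
    have h : (CyclotomicField.algebra 9 ℚ : Algebra ℚ (CyclotomicField 9 ℚ)) =
        DivisionRing.toRatAlgebra :=
      Subsingleton.elim _ _
    exact h ▸ CyclotomicField.isCyclotomicExtension 9 ℚ
  set F : IntermediateField ℚ (CyclotomicField 9 ℚ) := ⊤ with hFdef
  refine ⟨CyclotomicField 9 ℚ, inferInstance, inferInstance, hcyc, F, fun w hw ↦ ?_⟩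
  haveI : NumberField F := NumberField.of_module_finite ℚ _
  haveI hcycF : IsCyclotomicExtension {3 ^ (1 + 1)} ℚ F := by
    rw [show (3 : ℕ) ^ (1 + 1) = 9 by norm_num]
    have key := IsCyclotomicExtension.equiv {9} ℚ (CyclotomicField 9 ℚ)
      (IntermediateField.topEquiv (F := ℚ) (E := CyclotomicField 9 ℚ)).symm
    convert key
    exact Subsingleton.elim _ _
  -- the place data at `w`
  set ζ : F := IsCyclotomicExtension.zeta (3 ^ (1 + 1)) ℚ F with hζdef
  have hζ' : IsPrimitiveRoot ζ (3 ^ (1 + 1)) := IsCyclotomicExtension.zeta_spec (3 ^ (1 + 1)) ℚ F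
  have hζ : IsPrimitiveRoot ζ 9 := by norm_num at hζ'; exact hζ'
  obtain ⟨hπ, h3, hcop⟩ := placeData_nine (F := F) w hw
  -- the curve upstairs is the integer model, read in `F`
  have hWF : W.baseChange F = E₀.map (Int.castRingHom F) := by
    conv_lhs => rw [← map_integralModelInt W]
    rw [baseChange, map_map]
    congr 1
  rw [hWF, hasGoodReductionAt_iff_cubicModel]
  have eA : (E₀.map (Int.castRingHom F)).b₂ = ((A : ℤ) : F) := by rw [map_b₂, hA]; simp
  have eB : 8 * (E₀.map (Int.castRingHom F)).b₄ = ((B : ℤ) : F) := by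
    rw [map_b₄, hB]; push_cast; simp
  have eC : 16 * (E₀.map (Int.castRingHom F)).b₆ = ((C : ℤ) : F) := by
    rw [map_b₆, hC]; push_cast; simp
  rw [eA, eB, eC]
  exact hasGoodReductionAt_of_squareDisc hζ w hπ h3 hcop A B C v (256 * d₀) h3A hD hd hev hv1
    hv13 hc4

end Rat

end Summit.BirchSwinnertonDyer.BirchSwinnertonDyer.Theorems.GNineCriterion

/-! ### The registered stub, by name -/

namespace Summit.BirchSwinnertonDyer.BirchSwinnertonDyer.Cruxes.PSRankOneLowerHalfAtThree.Birth

open Summit.BirchSwinnertonDyer.BirchSwinnertonDyer.Theorems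

/-- **stub 1 of line `birth` (FIRST LEMMA `GNineCriterion`, size M), PROVED:** on the wild cell
at `3` (`ClassO6`: `3 ≠ 2`, additive at `3`, `ord₃ j ≥ 0`, `f₃ ≠ 2`), if the minimal discriminant
is a `3`-adic square (`ord₃ Δ_min` even and `Δ_min/3^{ord} ≡ 1 (mod 3)`) then `E` acquires good
reduction over a subfield of `ℚ(ζ₉)` (the tree's `TypeGNine`; here `F = ℚ(ζ₉)` itself).
Registered signature (`ledger skeleton check`, crux stmt-BirchSwinnertonDyer-21580).
[cite: Kraus1990, Théorème 1 (p = 3)] [cite: Delbourgo1998, §1.5 (G)] -/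
theorem stub_gNineCriterion :
    ∀ (W : WeierstrassCurve ℚ) [W.IsElliptic] [W.IsGloballyMinimal],
      Summit.BirchSwinnertonDyer.Rank1Residual.Additive.ClassO6 W 3 →
      Even (padicValInt 3 W.minimalDiscriminantInt) →
      W.minimalDiscriminantInt / 3 ^ padicValInt 3 W.minimalDiscriminantInt % 3 = 1 →
      Summit.BirchSwinnertonDyer.Rank1Residual.Additive.TypeGNine W := by
  intro W _ _ hO6 hev hsq
  exact GNineCriterion.typeGNine_of_square_minimalDiscriminant W hO6.2.1 hO6.2.2.1 hev hsq

end Summit.BirchSwinnertonDyer.BirchSwinnertonDyer.Cruxes.PSRankOneLowerHalfAtThree.Birth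

end
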